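import Summits.BirchSwinnertonDyer.BirchSwinnertonDyer.Theorems.KolyvaginRankRigidityAtTwoSwapOfNamedFacts
import Summits.BirchSwinnertonDyer.BirchSwinnertonDyer.Theorems.KolyvaginRankRigidityAtTwoKolyvaginCorankLowerBoundAtTwoMarginChebotarevOneClassIndexAtTwo
import Summits.BirchSwinnertonDyer.BirchSwinnertonDyer.Theorems.KolyvaginRankRigidityAtTwoKolyvaginCorankLowerBoundAtTwoThetaGlobalOrderLevelUp
import HarnessLib

/-!
# Crux U2 `FullClassDeepeningAtTwo` (stmt-BirchSwinnertonDyer-28084, LINE 14 of route `KolyvaginRankRigidityAtTwo`: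
# the TRANSPORT half of V1′∞) — the seed phase of the lossy prime swap at 2, FROM Gross 1991 Prop. 3.7 (2)

U2 (pen bsd-idea-1 g7): on the Heegner frame there is a constant `c` such that every NEARLY FULL Kolyvagin class
`2^{M−m−1} c_M(n) ≠ 0` (depth `r`, `M ≤ M(n)`, `c (m + r + 1) ≤ M`) can be moved to a conductor `n′` of the SAME depth
all of whose primes have index `≥ θ M′ + k`, for ANY `(θ, k)`, with `c_{M′}(n′) ≠ 0`. This is Stage 1 (the seed walk) of
the lead's lossy swap induction (`windowsRich_of_lossySwap`, p622030) run on its own: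
* `globalOrderLevelDownAtTwo` — one level DOWN (`2^{j+1} c_{M+1}(n) ≠ 0 ⇒ 2^j c_M(n) ≠ 0`, from the level link
  `ι_* c_M = 2 c_{M+1}`, `torsionH1OfDvd_kolyvaginClass_two_pow`), buying the margin one the swap needs at the primes of `n`;
* `seedTransport_of_lossySwap` — the walk: `r` swaps at a fixed level `M*` replacing the seed primes by fresh Kolyvagin
  primes of index `≥ I`, the exponent dropping by `c₂` per swap (hypothesis `hswap` = the registered S1L text on a frame);
* `fullClassDeepeningAtTwo_of_prop37 (h37) : FullClassDeepeningAtTwo` — BY NAME, with S1L := the lead's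
  `primeSwapAtTwoLossy_of_namedFacts h37` (p640628; constants `c₀ = 2 (c₁ + |Δ_min| + 19)`, `c₂ = c₁ + 6`), CHEB := S2
  `stub_chebotarevOneClassIndexAtTwo` (krr2-p2, `c₁`), `c := c₀ + 2 c₁ + 2 c₂ + 4`, working level `M′ = M − 1`, target index
  `I = θ M′ + k + M′ + 1` (informative because `M′ ≥ 2m + 2c₂ r + c₀ + 2c₁ + 2`).
HONEST FRAMING: CONDITIONAL on the named print fact `GrossLMS1991.prop37_2_frobeniusCongruence` (conditional-result);
`--supports` 28084; U1 `KolyvaginBoundedDefectAtTwo` (Kolyvagin's conjecture at 2, bounded defect) stays OPEN; the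
Birch–Swinnerton-Dyer conjecture is NOT proved by any of this.
References: [cite: Kolyvagin1991MathAnn, §2 (proof of Thm. 2.2: «by induction, replace p′₁,…,p′_f by p₁,…,p_f»), p. 257]
[cite: McCallumLMS1991, §5 Prop. 5.2, §4 (4)–(6)] [cite: WZhang2014, Lemma 8.4] [cite: GrossLMS1991, Prop. 3.7 (2)].
-/

set_option autoImplicit false
-- the Theorems namespace of this sub repeats the summit name by design (D-0017 nested layout)
set_option linter.dupNamespace false

noncomputable section

open scoped Classical

open WeierstrassCurve Field Literature.NumberTheory.EllipticCurves Literature.NumberTheory.EllipticCurves.KolyvaginCocycle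
  Literature.NumberTheory.EllipticCurves.ModularForms NumberField IsDedekindDomain
open Summit.BirchSwinnertonDyer.BirchSwinnertonDyer.Theses.KolyvaginRankRigidityAtTwo
open Literature.NumberTheory.EllipticCurves.GrossLMS1991 (prop37_2_frobeniusCongruence)

namespace Summit.BirchSwinnertonDyer.BirchSwinnertonDyer.Theorems.KolyvaginLowerBoundAtTwo

/-! ## §1 One level down -/

/-- **`2^{j+1} c_{M+1}(n) ≠ 0 ⇒ 2^j c_M(n) ≠ 0`** on the habitat, for a Kolyvagin conductor `n` with `M + 1 ≤ M(n)` and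
`1 ≤ M`: the level link `ι_* c_M(n) = 2 c_{M+1}(n)` (McCallum §4 (4)–(6)), read downwards.
[cite: McCallumLMS1991, §4 (4)–(6), Lemma 4.6] -/
theorem globalOrderLevelDownAtTwo (W : WeierstrassCurve ℚ) [W.IsElliptic] [W.IsGloballyMinimal]
    (hsur : ∀ m : ℕ, W.HasSurjectiveModNGaloisRep (2 ^ m : ℕ))
    (K : Type) [Field K] [NumberField K] (hK : IsImaginaryQuadratic K) (hne3 : NumberField.discr K ≠ -3)
    (hne4 : NumberField.discr K ≠ -4) (h2d : ¬ ((2 : ℤ) ∣ NumberField.discr K)) [NeZero (W.conductorNorm ℤ)]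
    (hHN : SatisfiesHeegnerHypothesis (W.conductorNorm ℤ) K)
    (Dt : ModularParametrizationData W (W.conductorNorm ℤ)) (β : ℤ) (ι : K →+* ℂ)
    (n : ℕ) (dat : KolyvaginHeegnerData Dt β ι n) (M j : ℕ)
    (hn : KolyvaginDescent.KolSupp (Zhang2014.IsKolyvaginPrime (W.conductorNorm ℤ) W K 2) n)
    (hlev : ((M + 1 : ℕ) : ℕ∞) ≤ Zhang2014.levelIndex W 2 n)
    (hne : ((2 ^ (j + 1) : ℕ) : ℤ) • dat.kolyvaginClass Nat.prime_two (M + 1) ≠ 0) :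
    ((2 ^ j : ℕ) : ℤ) • dat.kolyvaginClass Nat.prime_two M ≠ 0 := by
  have hD : NumberField.discr K < -4 :=
    Summit.BirchSwinnertonDyer.Rank1Residual.X11b.KolyvaginAssembly.discr_lt_neg_four hK ⟨hne3, hne4⟩
  have hodd : Odd (NumberField.discr K) :=
    Int.not_even_iff_odd.mp fun h ↦ h2d (even_iff_two_dvd.mp h)
  have hs2 : W.HasSurjectiveModNGaloisRep 2 := by simpa using hsur 1
  have hn0 : n ≠ 0 := hn.1.ne_zero
  -- the class at level `M + 1` is McCallum's class (it is non-zero)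
  have hne0 : dat.kolyvaginClass Nat.prime_two (M + 1) ≠ 0 := fun h ↦ hne (by rw [h, zsmul_zero])
  obtain ⟨hA', hP'⟩ := dat.kolyvaginClass_ne_zero hne0
  -- the standing inputs at level `M`
  have hA : IsAdmissible (absoluteGaloisGroup K) dat.pointsSubgroup ((2 ^ M : ℕ) : ℤ) :=
    KolyvaginAtTwo.isAdmissible_pointsSubgroup_two_of_heegner dat hs2 hK hodd hHN hn0 M
  have hkol : ∀ q ∈ n.primeFactors, Zhang2014.IsKolyvaginPrime (W.conductorNorm ℤ) W K 2 q ∧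
      M ≤ Zhang2014.kolyvaginIndex W 2 q := fun q hq ↦
    ⟨hn.2 q hq, Nat.le_of_succ_le ((Zhang2014.natCast_le_levelIndex_iff.mp hlev) q hq)⟩
  have hP : dat.toGeomPoints dat.derivedPoint ∈
      invPoints (absoluteGaloisGroup K) dat.pointsSubgroup ((2 ^ M : ℕ) : ℤ) :=
    Prop44.toGeomPoints_derivedPoint_mem_invPoints hK ι hD hHN Dt Nat.prime_two hn.1 hkol dat
  -- `ι_* (2^j c_M) = 2^j · 2 · c_{M+1} = 2^{j+1} c_{M+1} ≠ 0`
  intro h0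
  apply hne
  have h := congrArg (torsionH1OfDvd (W.baseChange K)
    (by exact_mod_cast pow_dvd_pow 2 (Nat.le_succ M) : ((2 ^ M : ℕ) : ℤ) ∣ ((2 ^ (M + 1) : ℕ) : ℤ))) h0
  rw [map_zero, map_zsmul, torsionH1OfDvd_kolyvaginClass_two_pow dat (Nat.le_succ M) hA hP hA' hP', smul_smul,
    ← Nat.cast_mul, ← pow_add, show j + (M + 1 - M) = j + 1 by omega] at h
  exact h

/-! ## §2 The seed walk at a fixed level -/

section Walk

variable {K : Type} [Field K] [NumberField K] (W : WeierstrassCurve ℚ) [W.IsGloballyMinimal]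
  [NeZero (W.conductorNorm ℤ)]
  (Dt : ModularParametrizationData W (W.conductorNorm ℤ)) (β : ℤ) (ι : K →+* ℂ)

/-- **The seed walk** (Kolyvagin, proof of Thm. 2.2: «by means of [1, Prop. 8] we can, by induction, replace
`p′₁, …, p′_f` by `p₁, …, p_f`»), lossy form at `2`: from a window `T₀` of Kolyvagin primes of index `≥ M* + 1`
carrying a class BIG at exponent `j` and a LOSSY swap `hswap` (constants `c₀`, `c₂`), informative down to exponent
`j − #T₀ · c₂`, a window `T′` of the same size on FRESH Kolyvagin primes of index `≥ I` carrying a class BIG at exponent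
`j − #T₀ · c₂`. [cite: Kolyvagin1991MathAnn, §2 (proof of Thm. 2.2)] [cite: McCallumLMS1991, §5 Prop. 5.2] -/
theorem seedTransport_of_lossySwap (c₀ c₂ : ℕ)
    (hswap :
        ∀ (M I : ℕ) (T : Finset ℕ) (a : ℕ)
          (dat : KolyvaginHeegnerData Dt β ι (∏ p ∈ T, p)) (j : ℕ) (X : Finset ℕ),
          1 ≤ M → M + 1 ≤ I →
          (∀ p ∈ T, Zhang2014.IsKolyvaginPrime (W.conductorNorm ℤ) W K 2 p ∧
            M + 1 ≤ Zhang2014.kolyvaginIndex W 2 p) →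
          a ∈ T → M + c₀ ≤ 2 * j →
          (∀ X' : Finset ℕ, ∃ q : ℕ, q ∉ X' ∧ Zhang2014.IsKolyvaginPrime (W.conductorNorm ℤ) W K 2 q ∧
            I ≤ Zhang2014.kolyvaginIndex W 2 q ∧
            ∃ v : HeightOneSpectrum (𝓞 K), ((q : ℕ) : 𝓞 K) ∈ v.asIdeal ∧
              ((2 ^ j : ℕ) : ℤ) • dat.kolyvaginClass Nat.prime_two M ∉
                (W.baseChange K).torsionLocalKer (v.adicCompletion K) ((2 ^ M : ℕ) : ℤ)) →
          ∃ ℓ : ℕ, ℓ ∉ X ∧ ℓ ∉ T ∧ Zhang2014.IsKolyvaginPrime (W.conductorNorm ℤ) W K 2 ℓ ∧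
            I ≤ Zhang2014.kolyvaginIndex W 2 ℓ ∧
            (∃ v : HeightOneSpectrum (𝓞 K), ((ℓ : ℕ) : 𝓞 K) ∈ v.asIdeal ∧
              ((2 ^ (j - c₂) : ℕ) : ℤ) • dat.kolyvaginClass Nat.prime_two M ∉
                (W.baseChange K).torsionLocalKer (v.adicCompletion K) ((2 ^ M : ℕ) : ℤ)) ∧
            ∃ dat' : KolyvaginHeegnerData Dt β ι (∏ p ∈ insert ℓ (T.erase a), p),
              (∀ X' : Finset ℕ, ∃ q : ℕ, q ∉ X' ∧ Zhang2014.IsKolyvaginPrime (W.conductorNorm ℤ) W K 2 q ∧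
                I ≤ Zhang2014.kolyvaginIndex W 2 q ∧
                ∃ v : HeightOneSpectrum (𝓞 K), ((q : ℕ) : 𝓞 K) ∈ v.asIdeal ∧
                  ((2 ^ (j - c₂) : ℕ) : ℤ) • dat'.kolyvaginClass Nat.prime_two M ∉
                    (W.baseChange K).torsionLocalKer (v.adicCompletion K) ((2 ^ M : ℕ) : ℤ)))
    {Ms I : ℕ} (hMs1 : 1 ≤ Ms) (hIMs : Ms + 1 ≤ I) (T₀ : Finset ℕ)
    (d₀ : KolyvaginHeegnerData Dt β ι (∏ p ∈ T₀, p))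
    (hT₀ : ∀ p ∈ T₀, Zhang2014.IsKolyvaginPrime (W.conductorNorm ℤ) W K 2 p ∧
      Ms + 1 ≤ Zhang2014.kolyvaginIndex W 2 p)
    {j : ℕ} (hrel : Ms + c₀ ≤ 2 * (j - T₀.card * c₂))
    (hBig₀ : ∀ X' : Finset ℕ, ∃ q : ℕ, q ∉ X' ∧ Zhang2014.IsKolyvaginPrime (W.conductorNorm ℤ) W K 2 q ∧
      I ≤ Zhang2014.kolyvaginIndex W 2 q ∧
      ∃ v : HeightOneSpectrum (𝓞 K), ((q : ℕ) : 𝓞 K) ∈ v.asIdeal ∧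
        ((2 ^ j : ℕ) : ℤ) • d₀.kolyvaginClass Nat.prime_two Ms ∉
          (W.baseChange K).torsionLocalKer (v.adicCompletion K) ((2 ^ Ms : ℕ) : ℤ)) :
    ∃ (T' : Finset ℕ) (dat' : KolyvaginHeegnerData Dt β ι (∏ p ∈ T', p)),
      T'.card = T₀.card ∧
      (∀ p ∈ T', Zhang2014.IsKolyvaginPrime (W.conductorNorm ℤ) W K 2 p ∧ I ≤ Zhang2014.kolyvaginIndex W 2 p) ∧
      (∀ X' : Finset ℕ, ∃ q : ℕ, q ∉ X' ∧ Zhang2014.IsKolyvaginPrime (W.conductorNorm ℤ) W K 2 q ∧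
        I ≤ Zhang2014.kolyvaginIndex W 2 q ∧
        ∃ v : HeightOneSpectrum (𝓞 K), ((q : ℕ) : 𝓞 K) ∈ v.asIdeal ∧
          ((2 ^ (j - T₀.card * c₂) : ℕ) : ℤ) • dat'.kolyvaginClass Nat.prime_two Ms ∉
            (W.baseChange K).torsionLocalKer (v.adicCompletion K) ((2 ^ Ms : ℕ) : ℤ)) := by
  set N := W.conductorNorm ℤ with hN
  set ν := T₀.card with hν
  have hrel' : ∀ c ≤ ν, Ms + c₀ ≤ 2 * (j - (ν - c) * c₂) := by
    intro c hc
    have h1 : (ν - c) * c₂ ≤ ν * c₂ := Nat.mul_le_mul_right c₂ (Nat.sub_le ν c)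
    omega
  -- invariant of the walk: `c` old primes remain, exponent `j - (ν - c) c₂`
  have walk : ∀ c : ℕ, c ≤ ν → ∀ (T : Finset ℕ) (dat : KolyvaginHeegnerData Dt β ι (∏ p ∈ T, p)),
      T.card = ν →
      (∀ p ∈ T, Zhang2014.IsKolyvaginPrime N W K 2 p ∧ Ms + 1 ≤ Zhang2014.kolyvaginIndex W 2 p) →
      (∀ p ∈ T, p ∉ T₀ → I ≤ Zhang2014.kolyvaginIndex W 2 p) →
      (T ∩ T₀).card = c →
      (∀ X' : Finset ℕ, ∃ q : ℕ, q ∉ X' ∧ Zhang2014.IsKolyvaginPrime N W K 2 q ∧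
        I ≤ Zhang2014.kolyvaginIndex W 2 q ∧
        ∃ v : HeightOneSpectrum (𝓞 K), ((q : ℕ) : 𝓞 K) ∈ v.asIdeal ∧
          ((2 ^ (j - (ν - c) * c₂) : ℕ) : ℤ) • dat.kolyvaginClass Nat.prime_two Ms ∉
            (W.baseChange K).torsionLocalKer (v.adicCompletion K) ((2 ^ Ms : ℕ) : ℤ)) →
      ∃ (T' : Finset ℕ) (dat' : KolyvaginHeegnerData Dt β ι (∏ p ∈ T', p)),
        T'.card = ν ∧
        (∀ p ∈ T', Zhang2014.IsKolyvaginPrime N W K 2 p ∧ I ≤ Zhang2014.kolyvaginIndex W 2 p) ∧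
        (∀ X' : Finset ℕ, ∃ q : ℕ, q ∉ X' ∧ Zhang2014.IsKolyvaginPrime N W K 2 q ∧
          I ≤ Zhang2014.kolyvaginIndex W 2 q ∧
          ∃ v : HeightOneSpectrum (𝓞 K), ((q : ℕ) : 𝓞 K) ∈ v.asIdeal ∧
            ((2 ^ (j - ν * c₂) : ℕ) : ℤ) • dat'.kolyvaginClass Nat.prime_two Ms ∉
              (W.baseChange K).torsionLocalKer (v.adicCompletion K) ((2 ^ Ms : ℕ) : ℤ)) := by
    intro c
    induction c with
    | zero =>
      intro _ T dat hcard hKol hfresh hc hBig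
      refine ⟨T, dat, hcard, fun p hp ↦ ⟨(hKol p hp).1, hfresh p hp ?_⟩, ?_⟩
      · intro hpT₀
        have : p ∈ T ∩ T₀ := Finset.mem_inter.mpr ⟨hp, hpT₀⟩
        rw [Finset.card_eq_zero] at hc
        simp [hc] at this
      · simpa only [Nat.sub_zero] using hBig
    | succ c ih =>
      intro hcν T dat hcard hKol hfresh hc hBig
      -- an old prime `a ∈ T ∩ T₀` to drop
      obtain ⟨a, ha⟩ : (T ∩ T₀).Nonempty := by
        rw [← Finset.card_pos, hc]; exact Nat.succ_pos c
      obtain ⟨haT, haT₀⟩ := Finset.mem_inter.mp ha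
      -- SWAP at level `M*`, the new prime outside `T ∪ T₀`
      obtain ⟨ℓ, hℓX, hℓT, hℓKol, hℓI, -, dat', hBig'⟩ :=
        hswap Ms I T a dat (j - (ν - (c + 1)) * c₂) (T ∪ T₀) hMs1 hIMs hKol haT
          (hrel' (c + 1) hcν) hBig
      have hℓT₀ : ℓ ∉ T₀ := fun h ↦ hℓX (Finset.mem_union_right _ h)
      have hexp : j - (ν - (c + 1)) * c₂ - c₂ = j - (ν - c) * c₂ := by
        have h1 : (ν - c) * c₂ = (ν - (c + 1)) * c₂ + c₂ := by
          have : ν - c = (ν - (c + 1)) + 1 := by omega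
          rw [this, Nat.add_mul, one_mul]
        omega
      refine ih (by omega) (insert ℓ (T.erase a)) dat' ?_ ?_ ?_ ?_ (by rw [← hexp]; exact hBig')
      · rw [Finset.card_insert_of_notMem (fun h ↦ hℓT (Finset.mem_of_mem_erase h)),
          Finset.card_erase_of_mem haT, hcard]
        omega
      · intro p hp
        rcases Finset.mem_insert.mp hp with rfl | hp'
        · exact ⟨hℓKol, by omega⟩
        · exact hKol p (Finset.mem_of_mem_erase hp')
      · intro p hp hpT₀
        rcases Finset.mem_insert.mp hp with rfl | hp'
        · exact hℓI
        · exact hfresh p (Finset.mem_of_mem_erase hp') hpT₀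
      · -- the number of old primes drops by one
        have h1 : insert ℓ (T.erase a) ∩ T₀ = (T ∩ T₀).erase a := by
          ext p
          simp only [Finset.mem_inter, Finset.mem_insert, Finset.mem_erase]
          constructor
          · rintro ⟨hp | ⟨hpa, hpT⟩, hpT₀⟩
            · exact absurd (hp ▸ hpT₀) hℓT₀
            · exact ⟨hpa, hpT, hpT₀⟩
          · rintro ⟨hpa, hpT, hpT₀⟩
            exact ⟨Or.inr ⟨hpa, hpT⟩, hpT₀⟩
        rw [h1, Finset.card_erase_of_mem ha, hc]
        omega
  exact walk ν le_rfl T₀ d₀ rfl hT₀ (fun p hp hpT₀ ↦ absurd hp hpT₀) (by rw [Finset.inter_self])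
    (by simpa only [Nat.sub_self, Nat.zero_mul, Nat.sub_zero] using hBig₀)

end Walk

/-! ## §3 U2 by name, from Gross 3.7 (2) -/

/-- **U2 `FullClassDeepeningAtTwo` from Gross 1991 Prop. 3.7 (2)**: the transport of a nearly full class to a
conductor of the same depth and arbitrary relative margin, by one level down, CHEB (S2), the seed walk with the
lead's lossy swap S1L (`primeSwapAtTwoLossy_of_namedFacts h37`), and the target index `I = θ M′ + k + M′ + 1`;
constant `c = c₀ + 2 c₁ + 2 c₂ + 4`. CONDITIONAL on the named print fact `prop37_2_frobeniusCongruence`;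
BSD is not proved by this. [cite: Kolyvagin1991MathAnn, §2 (proof of Thm. 2.2), p. 257]
[cite: McCallumLMS1991, §5 Prop. 5.2] [cite: GrossLMS1991, Prop. 3.7 (2)] -/
theorem fullClassDeepeningAtTwo_of_prop37 (h37 : prop37_2_frobeniusCongruence) : FullClassDeepeningAtTwo := by
  intro W _ _ hCM hred hsur K _ _ hK _ hHN hodd hne3 _ _ Dt β ι _
  classical
  haveI : Fact (Nat.Prime 2) := ⟨Nat.prime_two⟩
  set N := W.conductorNorm ℤ with hNdef
  have hne4 : NumberField.discr K ≠ -4 := fun h ↦ by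
    rw [h] at hodd; exact (Int.not_even_iff_odd.mpr hodd) ⟨-2, by norm_num⟩
  have h2d : ¬ ((2 : ℤ) ∣ NumberField.discr K) := fun h ↦
    (Int.not_even_iff_odd.mpr hodd) (even_iff_two_dvd.mpr h)
  obtain ⟨c₀, c₂, hS1⟩ := primeSwapAtTwoLossy_of_namedFacts h37 W hCM hred hsur K hK hne3 hne4 h2d hHN
  obtain ⟨c₁, hS2⟩ := stub_chebotarevOneClassIndexAtTwo W hCM hred hsur K hK hne3 hne4 h2d hHN
  refine ⟨c₀ + 2 * c₁ + 2 * c₂ + 4, ?_⟩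
  intro θ k r m M n d hn hr hlev hcM hne
  -- arithmetic of the constant
  have hcm : 2 * m ≤ (c₀ + 2 * c₁ + 2 * c₂ + 4) * m := Nat.mul_le_mul_right m (by omega)
  have hcr : 2 * c₂ * r ≤ (c₀ + 2 * c₁ + 2 * c₂ + 4) * r := Nat.mul_le_mul_right r (by omega)
  have hcr' : 2 * (c₂ * r) ≤ (c₀ + 2 * c₁ + 2 * c₂ + 4) * r := by rw [← mul_assoc]; exact hcr
  have hsplit : (c₀ + 2 * c₁ + 2 * c₂ + 4) * (m + r + 1) =
      (c₀ + 2 * c₁ + 2 * c₂ + 4) * m + (c₀ + 2 * c₁ + 2 * c₂ + 4) * r + (c₀ + 2 * c₁ + 2 * c₂ + 4) := by ring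
  have hM : 2 * m + 2 * (c₂ * r) + c₀ + 2 * c₁ + 4 ≤ M := by
    rw [hsplit] at hcM; omega
  -- the working level `M' = M - 1` (margin one at the primes of `n`)
  obtain ⟨Mw, rfl⟩ : ∃ Mw, M = Mw + 1 := ⟨M - 1, by omega⟩
  have hMw1 : 1 ≤ Mw := by omega
  have hlevMw : ((Mw : ℕ) : ℕ∞) ≤ Zhang2014.levelIndex W 2 n :=
    le_trans (by exact_mod_cast Nat.le_succ Mw) hlev
  have hidx : ∀ p ∈ n.primeFactors, Zhang2014.IsKolyvaginPrime N W K 2 p ∧ Mw + 1 ≤ Zhang2014.kolyvaginIndex W 2 p :=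
    fun p hp ↦ ⟨hn.2 p hp, (Zhang2014.natCast_le_levelIndex_iff.mp hlev) p hp⟩
  -- one level down: `2^{Mw - m - 1} c_{Mw}(n) ≠ 0`
  have hdown : ((2 ^ (Mw - m - 1) : ℕ) : ℤ) • d.kolyvaginClass Nat.prime_two Mw ≠ 0 := by
    refine globalOrderLevelDownAtTwo W hsur K hK hne3 hne4 h2d hHN Dt β ι n d Mw (Mw - m - 1) hn hlev ?_
    rw [show Mw - m - 1 + 1 = Mw + 1 - m - 1 by omega]
    exact hne
  -- CHEB: the class is BIG at exponent `j₀ = Mw - m - 1 - c₁` at fresh primes of index `≥ I`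
  set I : ℕ := θ * Mw + k + Mw + 1 with hI
  have hIMw : Mw + 1 ≤ I := by omega
  have hBig := hS2 Dt β ι n d Mw (Mw - m - 1) I hn hMw1 hlevMw (by omega) (by omega) hdown
  -- the seed walk on `T₀ = primeFactors n`
  set T₀ : Finset ℕ := n.primeFactors with hT₀
  have hprod₀ : ∏ p ∈ T₀, p = n := Nat.prod_primeFactors_of_squarefree hn.1
  let d₀ : KolyvaginHeegnerData Dt β ι (∏ p ∈ T₀, p) := hprod₀.symm ▸ d
  have hcl : ∀ M' : ℕ, d₀.kolyvaginClass Nat.prime_two M' = d.kolyvaginClass Nat.prime_two M' := by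
    intro M'
    change (hprod₀.symm ▸ d).kolyvaginClass Nat.prime_two M' = _
    exact kolyvaginClass_cast_swap hprod₀.symm d M'
  have hrel : Mw + c₀ ≤ 2 * (Mw - m - 1 - c₁ - T₀.card * c₂) := by
    rw [hT₀, hr, mul_comm r c₂]; omega
  obtain ⟨T', dat', hcard', hKol', hBig'⟩ := seedTransport_of_lossySwap W Dt β ι c₀ c₂ (hS1 Dt β ι) hMw1 hIMw T₀ d₀
    hidx hrel (fun X' ↦ by
      obtain ⟨q, hqX, hqKol, hqI, v, hv, hloc⟩ := hBig X'
      exact ⟨q, hqX, hqKol, hqI, v, hv, by rw [hcl]; exact hloc⟩)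
  -- reading off: `n' = ∏ T'`, `M' = Mw`
  have hT'prime : ∀ p ∈ T', p.Prime := fun p hp ↦ (hKol' p hp).1.1
  have hpf : (∏ p ∈ T', p).primeFactors = T' := Nat.primeFactors_prod hT'prime
  have hsupp : KolyvaginDescent.KolSupp (Zhang2014.IsKolyvaginPrime N W K 2) (∏ p ∈ T', p) :=
    ⟨Literature.NumberTheory.Sieve.FriedlanderIwaniecPrimesSquarefree.squarefree_prod_of_primes hT'prime,
      fun p hp ↦ (hKol' p (by rwa [hpf] at hp)).1⟩
  obtain ⟨q, -, -, -, v, -, hloc⟩ := hBig' ∅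
  refine ⟨∏ p ∈ T', p, dat', Mw, hsupp, by rw [hpf, hcard', hT₀, hr], hMw1, ?_, fun h0 ↦ hloc ?_⟩
  · rw [Zhang2014.natCast_le_levelIndex_iff]
    intro p hp
    rw [hpf] at hp
    have := (hKol' p hp).2
    omega
  · rw [h0, zsmul_zero]
    exact zero_mem _

end Summit.BirchSwinnertonDyer.BirchSwinnertonDyer.Theorems.KolyvaginLowerBoundAtTwo

end
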